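import Summits.Ventures.CertifiedManyBodySolver.Downfold.EmeryClusterFloorSeamFree
import HarnessLib

/-!
# The cluster-floor seam AT THE BOX'S OWN FILLING: four CuO₄-plus certificates bind a DOPED Emery box — the floor word
# `p ↦ m ≤ e(emeryLine s (coords p), emeryCellFilling p)` where every parameter vector carries its own `n_holes`

Venture CertifiedManyBodySolver, cell `pub/hubbard-downfold` (S1 = ROUTER), seat hubbard-downfold-mod-4 (S1/S2 Emery seam); namespace
`Summit.Ventures.CertifiedManyBodySolver.Downfold`. The La₂CuO₄ word (`EmeryBoxesLa214Floor54Word`, p629589) is stated at the parent filling ρ = 5/4 because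
box #18's companion has `n_holes = 1`. Most 3BE objects of record are DOPED columns (`router/EMERY-FLOOR-ORDERS.tsv`: Hg-1201 n_holes ∈ [1.125, 1.16], the
trilayer planes, NdNiO₂ …): their typed boxes carry an `nHoles` INTERVAL, so the cell filling `emeryCellFilling p = (6 − n_holes)/4` varies with the box point
(`S2SeamEmery.emeryCellFilling_mem_Icc`). A cluster certificate knows no filling: the SAME four tilted certificates `q₀ i` bound `e(θ, ρ)` at EVERY ρ by
`q₀ i/(4M) − μ i·ρ` (`le_emeryEnergyDensity_of_posSemidef_uniform_levelShift`), which is AFFINE in ρ — so a floor `m` that sits below the four tilted lines at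
BOTH ends of the filling interval sits below them on all of it. THIS FILE:

* `le_affine_of_endpoints` — `m ≤ a − μ·ρ` at `ρ_lo` and `ρ_hi` ⇒ on `[ρ_lo, ρ_hi]`;
* **`holdsOn_emeryEnergyFloorAtFilling_of_cuO4Certificates`** — ANY typed Emery box with the five seam entries AND an `nHoles` entry `eN` whose filling interval
  `[(6 − eN.hi)/4, (6 − eN.lo)/4]` lies in `[0, 3/2]`: four tilted CuO₄-plus certificates + `m` below the four tilted lines at both filling ends ⇒
  `HoldsOn (fun p => m ≤ emeryEnergyDensity (emeryLine s (emeryLineCoords εp p)) (emeryCellFilling p)) E` — the word a doped box wants; nothing else assumed;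
* `holdsOn_emeryEnergyFloorAtFilling_of_tiltedCornerCertificates` — the same on a general fitting window (`hfit`).

Everything PROVED (0 sorry); no definition. HONEST SCOPE: doors; no certificate, no number; SCREENING-GRADE box ends; for a parent box (point filling) this reduces to
the fixed-ρ doors of `EmeryClusterFloorSeamFree`.
-/

noncomputable section

namespace Summit.Ventures.CertifiedManyBodySolver.Downfold

open NonemptyInterval Matrix Finset Literature.Probability.LatticeModels
open Literature.MathematicalPhysics.QuantumLattice Literature.Computation.Certificates
open scoped BigOperators ComplexOrder

/-- **An affine bound checked at the ends of an interval holds on the interval**: `m ≤ a − μ·ρ_lo`, `m ≤ a − μ·ρ_hi`, `ρ ∈ [ρ_lo, ρ_hi]` ⇒ `m ≤ a − μ·ρ`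
(either sign of `μ`). [folklore] -/
theorem le_affine_of_endpoints {m a μ lo hi ρ : ℝ} (hlo : m ≤ a - μ * lo) (hhi : m ≤ a - μ * hi) (h1 : lo ≤ ρ) (h2 : ρ ≤ hi) :
    m ≤ a - μ * ρ := by
  rcases le_total 0 μ with hμ | hμ
  · have : μ * ρ ≤ μ * hi := mul_le_mul_of_nonneg_left h2 hμ
    linarith
  · have : μ * ρ ≤ μ * lo := mul_le_mul_of_nonpos_left h1 hμ
    linarith

/-- **DOPED-BOX FLOOR DOOR on a general fitting window.** Four tilted certificates at the lower-face corners (window `B` with covering hypothesis `hfit`,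
uniform weight of mass `M`) and a floor `m` below the four tilted lines `q₀ i/(4M) − μ i·ρ` at BOTH ends of the box's filling interval
`[(6 − eN.hi)/4, (6 − eN.lo)/4] ⊆ [0, 3/2]` give `m ≤ e(emeryLine s (emeryLineCoords εp p), emeryCellFilling p)` for every `p ∈ E`.
[cite: Anderson1951, eq. (2)] [cite: Israel1979, Thm. I.3.4] -/
theorem holdsOn_emeryEnergyFloorAtFilling_of_tiltedCornerCertificates {E : EmeryBox} {eA eB eD eUd eUp eN : Entry} {εp : ℚ}
    (hA : E .tpd = some eA) (hB : E .tpp = some eB) (hD : E .DeltaPd = some eD)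
    (hUd : E .Udd = some eUd) (hUp : E .Upp = some eUp) (hN : E .nHoles = some eN)
    (hρ0 : (0 : ℝ) ≤ ((((6 : ℚ) - eN.encl.snd) / 4 : ℚ) : ℝ)) (hρ1 : ((((6 : ℚ) - eN.encl.fst) / 4 : ℚ) : ℝ) ≤ 3 / 2)
    (s : Fin 4 → ℝ) (B : Finset (Site 2)) {M : ℝ} (hM : 0 < M)
    (hfit : ∀ (θ : Fin 14 → ℝ) (c : Cell liebPeriods) (X : Finset (Site 2)), cellPos c ∈ X → (emeryInteraction θ).Φ X ≠ 0 →
      ∃ v : Site 2, InCoset liebPeriods 0 v ∧ shiftSet v X ⊆ B)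
    (G : Fin 4 → FermionOp B) (hG0 : ∀ i, ∀ ω' : InfVolFermionState 2, ω'.IsPeriodic liebPeriods → (ω'.expect B (G i)).re = 0)
    (μ q₀ : Fin 4 → ℝ)
    (hq : ∀ i : Fin 4, ((⟨fun X => (uniformPeriodicWeight liebPeriods B M X : ℂ) •
        (emeryInteraction (emeryLine s (lowerCorner (emeryLo εp eA eB eD eUd eUp) (emeryHi εp eA eB eD eUd eUp) i) +
          μ i • levelDir)).Φ X⟩ : FermionInteraction 2).localHamiltonian B + G i - (q₀ i : ℂ) • (1 : FermionOp B)).PosSemidef)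
    {m : ℝ} (hmlo : ∀ i : Fin 4, m ≤ q₀ i / (4 * M) - μ i * ((((6 : ℚ) - eN.encl.snd) / 4 : ℚ) : ℝ))
    (hmhi : ∀ i : Fin 4, m ≤ q₀ i / (4 * M) - μ i * ((((6 : ℚ) - eN.encl.fst) / 4 : ℚ) : ℝ)) :
    HoldsOn (fun p : EmeryCoord → ℝ =>
      m ≤ emeryEnergyDensity (emeryLine s (emeryLineCoords (εp : ℝ) p)) (emeryCellFilling p)) E := by
  intro p hp
  have hρ := emeryCellFilling_mem_Icc (E := E) hN hp
  have hS : (emeryStates (emeryCellFilling p)).Nonempty :=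
    InfVolFermionState.emeryStates_nonempty (le_trans hρ0 hρ.1) (le_trans hρ.2 hρ1)
  exact holdsOn_emeryEnergyFloor_of_tiltedCornerCertificates hA hB hD hUd hUp s hS B hM hfit G hG0 μ q₀ hq
    (fun i => le_affine_of_endpoints (hmlo i) (hmhi i) hρ.1 hρ.2) p hp

/-- **DOPED-BOX FLOOR DOOR on the CuO₄ plus (turnkey).** Four tilted CuO₄-plus certificates and a floor below the four tilted lines at both ends of the
box's filling interval (⊆ [0, 3/2]) ⇒ `m ≤ e(emeryLine s (emeryLineCoords εp p), emeryCellFilling p)` on the whole typed box — the word a DOPED 3BE object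
wants; nothing assumed but the certificates. [cite: Anderson1951, eq. (2)] [cite: Israel1979, Thm. I.3.4] -/
theorem holdsOn_emeryEnergyFloorAtFilling_of_cuO4Certificates {E : EmeryBox} {eA eB eD eUd eUp eN : Entry} {εp : ℚ}
    (hA : E .tpd = some eA) (hB : E .tpp = some eB) (hD : E .DeltaPd = some eD)
    (hUd : E .Udd = some eUd) (hUp : E .Upp = some eUp) (hN : E .nHoles = some eN)
    (hρ0 : (0 : ℝ) ≤ ((((6 : ℚ) - eN.encl.snd) / 4 : ℚ) : ℝ)) (hρ1 : ((((6 : ℚ) - eN.encl.fst) / 4 : ℚ) : ℝ) ≤ 3 / 2)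
    (s : Fin 4 → ℝ) {M : ℝ} (hM : 0 < M)
    (G : Fin 4 → FermionOp emeryCuO4Window)
    (hG0 : ∀ i, ∀ ω' : InfVolFermionState 2, ω'.IsPeriodic liebPeriods → (ω'.expect emeryCuO4Window (G i)).re = 0)
    (μ q₀ : Fin 4 → ℝ)
    (hq : ∀ i : Fin 4, ((⟨fun X => (uniformPeriodicWeight liebPeriods emeryCuO4Window M X : ℂ) •
        (emeryInteraction (emeryLine s (lowerCorner (emeryLo εp eA eB eD eUd eUp) (emeryHi εp eA eB eD eUd eUp) i) +
          μ i • levelDir)).Φ X⟩ : FermionInteraction 2).localHamiltonian emeryCuO4Window + G i -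
        (q₀ i : ℂ) • (1 : FermionOp emeryCuO4Window)).PosSemidef)
    {m : ℝ} (hmlo : ∀ i : Fin 4, m ≤ q₀ i / (4 * M) - μ i * ((((6 : ℚ) - eN.encl.snd) / 4 : ℚ) : ℝ))
    (hmhi : ∀ i : Fin 4, m ≤ q₀ i / (4 * M) - μ i * ((((6 : ℚ) - eN.encl.fst) / 4 : ℚ) : ℝ)) :
    HoldsOn (fun p : EmeryCoord → ℝ =>
      m ≤ emeryEnergyDensity (emeryLine s (emeryLineCoords (εp : ℝ) p)) (emeryCellFilling p)) E :=
  holdsOn_emeryEnergyFloorAtFilling_of_tiltedCornerCertificates hA hB hD hUd hUp hN hρ0 hρ1 s emeryCuO4Window hM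
    (fun θ => emeryCuO4Window_fit θ) G hG0 μ q₀ hq hmlo hmhi

/-- **La₂CuO₄ consistency check**: on the parent companion (`n_holes = 1`) the at-filling word IS the ρ = 5/4 word — `emeryCellFilling p = 5/4` for every
`p ∈ emeryBoxLa214v122`. [cite: ArakiMoriya2003, §4.1 Def. 4.5] -/
theorem emeryBoxLa214v122_emeryCellFilling_eq {p : EmeryCoord → ℝ} (hp : emeryBoxLa214v122.Mem p) : emeryCellFilling p = 5 / 4 := by
  have h := emeryBoxLa214v122_cellFilling hp
  rw [Set.mem_Icc] at h
  have h1 : ((((6 : ℚ) - 1) / 4 : ℚ) : ℝ) = 5 / 4 := by norm_num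
  rw [h1] at h
  exact le_antisymm h.2 h.1

end Summit.Ventures.CertifiedManyBodySolver.Downfold

end
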